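import Mathlib
import HarnessLib
import HarnessLib.Audit
import Summits.CriticalPhenomena.Statement

/-!
Route: PercBoundarySqueeze

DORMANT since 2026-08-26T09:39:59Z (reconciler: no traction for 8.4 d (last activity item-evidence-added at 2026-08-18T00:26:06Z); parked, not closed — `ledger route dormant route-CriticalPhenomena-PercBoundarySqueeze --off` to reactiva) — unstaffed, not closed; items shared with open routes are served there. `ledger route dormant <id> --off` reactivates.

# Route PercBoundarySqueeze — boundary-arm exit count squeezes θ(p_c) against fat free-box clusters

It suffices to show X = Q1 ∧ Q2, two rate statements AT p = p_c(ℤ³) for bond percolation (P =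
P_{p_c}, H = {x ∈ ℤ³ | x₀ ≥ 0},
Λ_R = box 3 R = {−R,…,R}³, C_{Λ_R}(x) = cluster of x using open edges with both ends in Λ_R):
 Q1 (HalfSpaceOneArmRate, quantitative Barsky–Grimmett–Newman): ∃ b > 1/2, C: P(0 ↔ sup-distance ≥ r
inside H) ≤ C r^{−b} for r ≥ 1
 (numerically b = x_s ≈ 0.975);
 Q2 (FreeBoxFatClusterMass): ∃ δ > 0, C: Σ_{x ∈ Λ_R} P(|C_{Λ_R}(x)| ≥ R^{3/2}) ≤ C R^{3−δ} for R ≥ 1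
— the expected number of sites of the
 box lying in box-clusters of at least R^{3/2} vertices is polynomially smaller than the volume
(numerically δ = (3/2)(τ−2) ≈ 0.28).
Realises card boundary-critical-squeeze in its (Box) form, with the card's Cauchy–Schwarz /
susceptibility pairing (numerically shut,
refuter audit 2026-08-15: exponent +0.07) replaced by a volume-THRESHOLD split, which is live with
margins 0.47 (Q1) and 0.28 (Q2).
Lean: `(∃ b C : ℝ, 1 / 2 < b ∧ ∀ r : ℕ, 1 ≤ r → (Literature.Probability.Percolation.bondPercolation
(Literature.Probability.LatticeModels.zdGraph 3) (Literature.Probability.Percolation.criticalProbI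
3)).real {ω | ∃ y : Literature.Probability.LatticeModels.Site 3, (∃ i : Fin 3, (r : ℤ) ≤ |y i|) ∧ ω
∈ Literature.Probability.Percolation.openConnIn {x : Literature.Probability.LatticeModels.Site 3 | 0
≤ x 0} 0 y} ≤ C * (r : ℝ) ^ (-b)) ∧ (∃ δ C : ℝ, 0 < δ ∧ ∀ R : ℕ, 1 ≤ R → ∑ x ∈
Literature.Probability.LatticeModels.box 3 R, (Literature.Probability.Percolation.bondPercolation
(Literature.Probability.LatticeModels.zdGraph 3) (Literature.Probability.Percolation.criticalProbI
3)).real {ω | ∃ T : Finset (Literature.Probability.LatticeModels.Site 3), Nat.sqrt (R ^ 3) ≤ T.card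
∧ ∀ y ∈ T, ω ∈ Literature.Probability.Percolation.openConnIn
(↑(Literature.Probability.LatticeModels.box 3 R) : Set (Literature.Probability.LatticeModels.Site
3)) x y} ≤ C * (R : ℝ) ^ ((3 : ℝ) - δ))`

## Assembly
Given the two supports the assembly is real arithmetic (~60 lines): fix R ≥ 2 and take n =
Nat.sqrt(R³) ≤ R^{3/2} in FreeBoxSqueeze;
BoundaryArmCount and Q1 at r = ⌊R/2⌋ ≥ 1 bound the first term by R^{3/2} · 6(2R+1)² · C ⌊R/2⌋^{−b} ≤
C′ R^{7/2 − b}; Q2 bounds the second by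
C R^{3−δ} (the sum over Λ_{⌊R/2⌋} is at most the sum over Λ_R, and Nat.sqrt(R³) ≤ #T is exactly Q2's
event); |Λ_{⌊R/2⌋}| = (2⌊R/2⌋+1)³ ≥ R³.
Hence 0 ≤ θ(p_c) ≤ C′ R^{1/2 − b} + C R^{−δ} for all R ≥ 2 with b > 1/2, δ > 0, so θ(p_c) = 0, i.e.
PercolationContinuityZ3
(percolationContinuityZ3_iff). No standard reduction beyond θ_x = θ_0 is used.

Rationale: WHY THIS LINE. A jump θ(p_c) = θ* > 0 must be carried, inside every box Λ_R, by box-clusters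
("pieces") that EXIT through ∂Λ_R; a piece meeting the core Λ_{R/2}
owns a boundary vertex with an inward half-space arm of length ≥ R/2, so the expected number of such
pieces is ≤ 6(2R+1)² π_H(R/2) — the
boundary-arm counting engine of Zhang2000 (critical max-flow o(n²) from BarskyGrimmettNewman1991 =
Grimmett1999 Thm (7.35), θ_H(p_c) = 0, PROVED
in tree: BarskyGrimmettNewman1991_Z3_holds). Splitting pieces at volume n gives the UNCONDITIONAL
squeeze θ(p_c)|Λ_{R/2}| ≤ n·E[#boundary vertices
joined to the core] + E#{x ∈ Λ_{R/2} : |C_{Λ_R}(x)| ≥ n} (support FreeBoxSqueeze, provable now): few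
exits force fat pieces. With n = R^{3/2} the
first term is o(R³) iff π_H decays faster than r^{−1/2} (Q1) and the second iff R^{3/2}-fat pieces
carry o(R³) mass (Q2). The card's version paired
the exit count with the second moment Σ|K|² = free-box susceptibility, whose exponent γ/ν = 2 − η
carries the wrong sign of η (η(3) ≈ −0.046,
EtaNegativePredictionZ3; audit: x_s > 1 − η fails by 0.07); the threshold count sees only τ − 2 =
β/(β+γ) ≈ 0.19 and x_s ≈ 0.975 (DengBlote2005),
and the general j-moment criterion max(0, d_f j − β/ν) < (1 + x_s) j holds for all j < 0.87 (card =
j = 1). Imported areas: surface critical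
phenomena (boundary exponents of 3D percolation) as the quantitative input, and an extremal counting
split (pieces × sizes) instead of Cauchy–Schwarz;
no spectral, transfer or renormalisation step — nothing moves p, so the SprinklingRenormalisation
barrier is met only inside crux Q1. Unlike route
PercLowPointHalfSpace (low-point identity; boundary TWO-arm repulsion a₂ > 5/2 and tall-cluster mass
m ≤ 11/4) the second input here is a bulk
VOLUME-tail statement and the assembly is a dozen lines; unlike PercHalfSpace (closed) no same-p
transfer θ > 0 ⇒ θ_H > 0 is asked.

RANKED CRUXES. #2 FreeBoxFatClusterMass (crux) — (card Q2, box form, threshold version) at p_c(ℤ³):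
∃ δ > 0, C such that for every R ≥ 1, Σ_{x ∈ Λ_R} P(|C_{Λ_R}(x)| ≥ ⌊R^{3/2}⌋) ≤ C R^{3−δ}, where
C_{Λ_R}(x) = {y : x ↔ y by an open path inside Λ_R} (event: some finset T with Nat.sqrt(R³) ≤ #T of
vertices joined to x inside the box). Scaling truth δ = (3/2)(τ − 2) ≈ 0.28; a jump world with
unique dense giant has LHS ≥ cθ*R³; a jump world obeying Q1 too (exits ≤ CR^{3/2}) is excluded by
the assembly. This is where the absurd world dies. [difficulty: open-problem] (why it might fail: No
upper bound on critical cluster VOLUMES exists in d=3 (even τ_{p_c}→0 is open); the visible engine,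
a bulk one-arm bound at scale √R, is already conjunct-strength; a jump world with r^{-1/2} ≲ π_H(r)
→ 0 satisfies Q2, so Q2 is true there and useless — only Q1 excludes it.)
[BorgsChayesKestenSpencer1999, Hutchcroft2020, AizenmanBarsky1987, Aizenman1997,
doi:10.1103/PhysRevE.98.022120, KozmaNitzan2024]
#3 HalfSpaceOneArmRate (crux) — (card Q1 with the rate the assembly needs) quantitative
Barsky–Grimmett–Newman at p_c(ℤ³): ∃ b > 1/2, C with P(∃ y, ‖y‖_∞ ≥ r ∧ 0 ↔ y inside H = {x₀ ≥ 0}) ≤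
C r^{−b} for all r ≥ 1. Same event as PercLowPointHalfSpace.QuantitativeBGN
(stmt-CriticalPhenomena-0913, ∃ a > 0), with the explicit threshold 1/2; numerically b = x_s = 2 −
y_{h1} ≈ 0.975 (DengBlote2005), rigorously b ≤ 2 (φ_{p_c}(Λ_r) ≥ 1). Publishable alone. [difficulty:
open-problem] (why it might fail: BGN (Grimmett1999 Thm 7.35) is soft — a finite-size criterion by
contradiction, no rate in print for d=3 (KozmaNitzan2024 §1); b > 1/2 needs a QUANTIFIED half-space
shell-crossing defect (≥ 0.3 per dyadic scale) or multi-scale steering, an RSW-type input unknown in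
3D.) [BarskyGrimmettNewman1991, Grimmett1999, KozmaNitzan2024, DengBlote2005, ChatterjeeHanson2020,
DuminilCopinTassionCMP2016]
#9 FreeBoxSqueeze (support) — UNCONDITIONAL squeeze (provable now, ~150 lines): for all R, n ≥ 1,
θ(p_c)·|Λ_{⌊R/2⌋}| ≤ n · Σ_{v ∈ ∂^{in}Λ_R} P(v ↔ Λ_{⌊R/2⌋} inside Λ_R) + Σ_{x ∈ Λ_{⌊R/2⌋}}
P(|C_{Λ_R}(x)| ≥ n). Proof: pointwise, Σ_{x ∈ core} 1{x ↔ ∞} ≤ Σ_{x∈core} 1{x ↔ ∂^{in}Λ_R in Λ_R} =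
Σ_{exit pieces K} |K ∩ core| ≤ n·#{exit pieces meeting the core} + #{x ∈ core : |C_{Λ_R}(x)| ≥ n},
and each exit piece meeting the core contains its own inner-boundary vertex joined to the core
inside Λ_R; take expectations (translation invariance θ_x = θ_0; measurability of openConnIn events,
in tree). [difficulty: provable-now] [Zhang2000, AizenmanDuminilCopinSidoraviciusCMP2015,
Grimmett1999]
#9 BoundaryArmCount (support) — (provable now, lattice-symmetry bookkeeping, ~200 lines) for R ≥ 1:
Σ_{v ∈ ∂^{in}Λ_R} P(v ↔ Λ_{⌊R/2⌋} inside Λ_R) ≤ 6(2R+1)² · P(∃ y, (∃ i, ⌊R/2⌋ ≤ |y_i|) ∧ 0 ↔ y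
inside H): a vertex v on the face {x_i = ±R} joined inside Λ_R to the core is, after the lattice
automorphism (reflection x_i ↦ R ∓ x_i, coordinate swap i ↔ 0, horizontal translation v ↦ 0;
bondPercolation is invariant, LatticeSymmetry/BondPercolationSymmetry in tree), the origin joined
inside H to a point y with y₀ ≥ R − ⌊R/2⌋ ≥ ⌊R/2⌋; |∂^{in}Λ_R| ≤ 6(2R+1)². [difficulty:
provable-now] [Zhang2000, BarskyGrimmettNewman1991, Grimmett1999]

TWO-LAYER PLAN. Foreseen glued splits (none filed now). Q1 ⇐ HalfSpaceShellDefect (∃ c ≥ 0.3: at p_c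
the patch Λ_r ∩ ∂H is NOT joined inside H ∩ Λ_{2r}
to ∂Λ_{2r} with probability ≥ c, all r) → DyadicMultiplicativity (π_H(2^k) ≤ Π (1 − c_j) up to
constants) → Q1; the weaker 'any c > 0' gives
only PercLowPointHalfSpace.QuantitativeBGN (some rate), so the defect must be quantified or improved
across scales. Q2 ⇐ VolumeFromFewLargePieces
(a BCKS-type counting: at most M disjoint pieces of diameter ≥ R^{1/2} in Λ_R with E M ≤ C
R^{3−3/2−δ′}) → PieceVolumeCap (a piece of Λ_R has
≤ R^{3/2−δ″}·(diam)^{…} vertices outside a polynomially rare event) → Q2. Thresholds (volume R^{a},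
rate b) = (3/2, 1/2) can be re-balanced by a
restate along a − 1 < b ≤ x_s ≈ 0.975 if one side moves first (a ∈ (1, 1.97); scaling margin of Q2
at threshold a is a(τ−2) ≈ 0.19a).

KILL CRITERIA. Refuted:FreeBoxFatClusterMass (e.g. a theorem that R^{3/2}-fat box-clusters carry ≥
cR³ expected mass at p_c, or numerics showing
Σ_x P(|C_{Λ_R}(x)| ≥ R^{3/2})/R³ ↛ 0) closes the route unless a restate with a larger volume
threshold R^{a}, a < 1 + b, survives together
with a correspondingly stronger Q1 — if the needed b exceeds x_s ≈ 0.975 the line is dead: close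
refuted. Refuted:HalfSpaceOneArmRate is
impossible in the real world short of x_s ≤ 1/2 (contradicting DengBlote2005 by 0.47); a proof that
NO polynomial rate holds would refute BGN
numerics, not just this route. A refuter showing FreeBoxSqueeze or BoundaryArmCount false as typed
(an indexing slip) forces a restate, not a
close. Mooted (superseded) if PercLowPointHalfSpace closes, or if a bulk one-arm polynomial bound /
uniform crossing bound (PercAnnulusCrossing,
PercOpenSupercrit R4) is proved — those imply the conjunct directly.

NOT DECOMPOSED YET. The engines: for Q1 the half-space shell defect and its multi-scale bookkeeping
(BGN steering made quantitative); for Q2 any volume-based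
device (BorgsChayesKestenSpencer1999-type piece counting under partial crossing information,
Hutchcroft2020's volume differential inequality
run down to p_c with the box cutoff |C_{Λ_R}| ≤ (2R+1)³, Kesten–Zhang coarse graining at the same
p). Constants and the lattice-automorphism
lemmas inside BoundaryArmCount; the fractional-moment (Hölder) variant θ^{1+j} ≤ C (π_H(R/2)/R)^j ·
avg_x E|C_{Λ_R}(x)|^j (equivalent content,
not filed); the slab form of the card (dropped: at volumes < k² the slab is bulk-like, planarity
never enters, and it is strictly stronger than
the box form). Prior programme notes: not consulted (plancard mode).

CHEAPEST FALSIFIER. Exponent arithmetic first (done, this session): with τ − 2 = 0.189, d_f = 2.523,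
x_s = 0.975 the pair (Q1: b > 1/2, Q2: threshold R^{3/2})
has scaling margins 0.47 and 0.28; the card's own pairing (j = 1) has −0.07 — refuters should
re-derive max(0, d_f j − β/ν) < (1 + x_s) j ⇔
j < 0.87. Then Monte Carlo (kit, < 1 cpu-hour, bond p_c = 0.2488118): (i) V(R) = Σ_{x∈Λ_R}
1{|C_{Λ_R}(x)| ≥ R^{3/2}}/|Λ_R| for R = 8…64,
predicted slope −0.28 (a slope > −0.1 or a plateau kills Q2's liveness); (ii) π_H(r) for r ≤ 48,
predicted slope −0.975 (a fitted slope
> −0.6 would put Q1's threshold 1/2 in doubt). Literature lookup: any printed rate for θ_H /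
half-space one-arm at p_c(ℤ³) (none found;
KozmaNitzan2024 §1 item 4 treats BGN corollaries as unpublished folklore).

NUMBERS. Physics numerics (not used in any proof): x_s = 2 − y_{h1} = 0.9754(4) (ordinary surface
transition, DengBlote2005); τ = 2.189(2)
(doi:10.1103/PhysRevE.57.230; τ = 2.1892(1) for d = 3 hypercubic, doi:10.1103/PhysRevE.98.022120),
d_f = y_h = 2.523 (doi:10.1103/PhysRevE.87.052107), so τ − 2 = β/(β+γ) = (3 − d_f)/d_f = 0.189, β/ν
= 0.477,
γ/ν = 2 − η = 2.046 (η = −0.046, EtaNegativePredictionZ3 in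
Literature.Barriers.CriticalPhenomena.GaussianDominationRoute); p_c^{bond}(ℤ³) =
0.2488118. Scaling predictions: π_H(r) ≈ r^{−0.975}; Σ_{x∈Λ_R} P(|C_{Λ_R}(x)| ≥ R^{a}) ≈ R^{3 −
0.189a} for a ≤ d_f; criterion of the squeeze
with volume threshold R^{a}: a − 1 < b, live for a ∈ (1, 1.975). Rigorous anchors: π_H(r) ≥ c r^{−2}
(φ_{p_c}(Λ_r) ≥ 1, DuminilCopinTassionCMP2016),
so b ≤ 2; P_{p_c}(|C| ≥ n) ≥ c n^{−1/2} (AizenmanBarsky1987), consistent with δ ≤ 3/4; mean field (d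
> 6): b = 3 (ChatterjeeHanson2020), δ = 3/4 — the squeeze
is live there too; d = 2 calibration: x_s = 1/3 < 1/2, so the pair (3/2, 1/2) is NOT live in the
plane, but (a, b) = (5/4, 1/4) is (τ₂ − 2 = 5/91,
all inputs theorems by RSW) — the form is d-uniform, the thresholds are d-dependent, and the d = 3
content is the two rates. Items at open: 5 (2 cruxes, 2 supports, 1 assembly).

DEFINITION REQUESTS. None: bondPercolation, criticalProbI, openConnIn, theta
(Literature.Probability.Percolation), box, innerBoundary, zdGraph, Site
(Literature.Probability.LatticeModels) exist; all five decls elaborate (planner Sketch.lean, lean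
check rc 0).

Novelty: Searches (2026-08-15): `lit search --hybrid "critical percolation half-space boundary one-arm
exponent three dimensions surface exponent"` (12
textbook hits, none on rates); `lit search --source s2 "critical value maximal flow percolation
Zhang 2000"` (1 relevant: doi:10.1023/a:1018631726709);
`lit search --source zbmath "percolation half-space critical exponents boundary"` (3:
ChatterjeeHanson2020 d > 6, two KPZ); `lit galaxy search
"percolation in half-spaces" --star all` (3 pdf hits: brochette, defects on slabs, ALEA sublattice —
none on critical rates); `lit frontier
CriticalPhenomena --since 2020` (30 rows, none on half-space rates or free-box volume tails); `lit
read arXiv:2401.12397` §1 (the five folklore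
approaches); openalex/arxiv/s2 follow-up queries on 'critical cluster volume tail three dimensions'
rate-limited (HTTP 429) — declared; `lit galaxy search --star pdf --mode bm25 "quantitative rate of
decay for percolation in a half-space at
criticality Barsky Grimmett Newman, boundary one-arm exponent, number of boundary vertices connected
to distance n"` (12 hits, none relevant;
nearest doi:10.1103/PhysRevE.98.022120 = Fisher exponent τ numerics). Also read: the card + its
audit, the 9 route files of the sub, cards sign-of-eta-bk-plus and free-box-folklore-knife-edge
(the j = 1 / L² knife-edge family), Literature UniqueClusterDensityBound (ADS Schwarz bound),
HalfSpace/HalfSpaceSlab (BGN, DST proved).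
Nearest prior art found: Zhang2000 (doi:10.1023/a:1018631726709: b  [refs: 10.1023/a:1018631726709, 10.1103/PhysRevE.98.022120, 10.1023/a:1018631726709:, 2401.12397, doi:10.1023/a, doi:10.1103/PhysRevE.98.022120, ChatterjeeHanson2020, Zhang2000, AizenmanDuminilCopinSidoraviciusCMP2015, KozmaNitzan2024, VandenbergVanengelenburg2022, BorgsChayesKestenSpencer1999]

Barriers (technique_class: boundary-arm-count, halfspace-arm-rate, volume-tail): - technique_class: boundary-arm-count, halfspace-arm-rate, volume-tail
- Literature.Barriers.CriticalPhenomena.SprinklingRenormalisation: evaded in form — no block scheme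
and no parameter shift anywhere; BGN enters only through its conclusion inside H, where Grimmett1999
p.162 needs 'no extra money'; the barrier's substance (steering acquires negative information)
reappears honestly as the difficulty of a RATE in crux HalfSpaceOneArmRate.
- Literature.Barriers.CriticalPhenomena.SlabLimitUniformControl: not engaged — the card's slab form
is dropped; no k → ∞ limit of slab quantities and no uniform modulus near p_c(S_k) is used (DST's
theorem is not even needed; BGN_Z3 is proved in tree).
- Literature.Barriers.CriticalPhenomena.SpanningClustersAboveSix: consistent — the squeeze never
assumes tight spanning-cluster counts; the exit bound R^{d−1−b} exceeds Aizenman's R^{d−6}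
proliferating clusters, and in mean field (b = 3, δ = 3/4) both cruxes and the conclusion hold; the
mechanism is d-uniform and its d = 3 content is purely the two rates.
- Literature.Barriers.CriticalPhenomena.GaussianDominationRoute: interacts through
EtaNegativePredictionZ3 only as diagnosis — η < 0 is exactly what shut the card's j = 1 pairing
(needs x_s > 1 − η); the threshold pairing does not see η; no infrared bound is used or implied.
- Literature.Barriers.CriticalPhenomena.LongRangeDiscontinuity: evaded by range-sensitivity — exits
of a box-cluster happen at ∂Λ_R only for finite-range edges; for the 1

History (route lifecycle, newest last):
- 2026-08-26T09:39:59Z · DORMANT — reconciler: no traction for 8.4 d (last activity item-evidence-added at 2026-08-18T00:26:06Z); parked, not closed — `ledger route dormant route-CriticalPhenomen (operator:999:998459)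

sub-problem: PercolationContinuityZ3 · status: dormant · opened planner-plancard-CriticalPhenomena-Percolatio-98508877-0 2026-08-15T11:58:42Z · rev 3 · ledger route-CriticalPhenomena-PercBoundarySqueeze
GENERATED by the gate from the ledger (D-0016/17). Provers cite these decls: `theorem foo : Summit.CriticalPhenomena.PercolationContinuityZ3.Theses.PercBoundarySqueeze.<Decl> := …` in Summits/CriticalPhenomena/PercolationContinuityZ3/Theorems/<Name>.lean.
-/

namespace Summit.CriticalPhenomena.PercolationContinuityZ3.Theses.PercBoundarySqueeze

open scoped BigOperators Topology Manifold Classical MeasureTheory ProbabilityTheory Matrix InnerProductSpace ComplexConjugate ContinuousMap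
open Filter Set Function TopologicalSpace MeasureTheory

attribute [summit_statement] _root_.PercolationContinuityZ3

/-- item stmt-CriticalPhenomena-6982 · crux · rank 2 · open · by planner
why it might fail: No polynomial UPPER bound on critical cluster volumes is known in d=3: only P_{p_c}(|C|>=n) >= c n^{-1/2} (Grimmett1999 Prop 10.29) and mean field d>=11; the box-free analogue already implies theta(p_c)=0. False if the fat box-cluster mass fraction decays sub-polynomially, or with a dense box giant.
sources: AizenmanBarsky1987, Grimmett1999, Hutchcroft2020, BorgsChayesKestenSpencer1999, Aizenman1997, FitznerVanDerHofstad2017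
[crux] (card Q2, box form, threshold version) at p_c(ℤ³): ∃ δ > 0, C such that for every R ≥ 1, Σ_{x
∈ Λ_R} P(|C_{Λ_R}(x)| ≥ ⌊R^{3/2}⌋) ≤ C R^{3−δ}, where C_{Λ_R}(x) = {y : x ↔ y by an open path inside
Λ_R} (event: some finset T with Nat.sqrt(R³) ≤ #T of vertices joined to x inside the box). Scaling
truth δ = (3/2)(τ − 2) ≈ 0.28; a jump world with unique dense giant has LHS ≥ cθ*R³; a jump world
obeying Q1 too (exits ≤ CR^{3/2}) is excluded by the assembly. This is where the absurd world dies.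
[difficulty: open-problem] -/
@[route_item "route-CriticalPhenomena-PercBoundarySqueeze"]
def FreeBoxFatClusterMass : Prop :=
  ∃ δ C : ℝ, 0 < δ ∧ ∀ R : ℕ, 1 ≤ R → ∑ x ∈ Literature.Probability.LatticeModels.box 3 R, (Literature.Probability.Percolation.bondPercolation (Literature.Probability.LatticeModels.zdGraph 3) (Literature.Probability.Percolation.criticalProbI 3)).real {ω | ∃ T : Finset (Literature.Probability.LatticeModels.Site 3), Nat.sqrt (R ^ 3) ≤ T.card ∧ ∀ y ∈ T, ω ∈ Literature.Probability.Percolation.openConnIn (↑(Literature.Probability.LatticeModels.box 3 R) : Set (Literature.Probability.LatticeModels.Site 3)) x y} ≤ C * (R : ℝ) ^ ((3 : ℝ) - δ)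

/-- item stmt-CriticalPhenomena-6983 · crux · rank 3 · open · by planner
why it might fail: BGN theta_H(p_c)=0 (Grimmett1999 Thm 7.35, proved in tree) is a soft finite-size contradiction: no rate for d=3, printed rates only in high d (b=3: ChatterjeeHanson2020 Thm 1(a), arXiv:2512.13624). b>1/2 is d-specific: FALSE in d=2 (half-plane one-arm exponent 1/3); d=3 rests on numerics x_s~0.975.
sources: BarskyGrimmettNewman1991, Grimmett1999, Literature.Probability.Percolation.BarskyGrimmettNewman1991_Z3, ChatterjeeHanson2020, arXiv:2512.13624, KozmaNitzan2024
[crux] (card Q1 with the rate the assembly needs) quantitative Barsky–Grimmett–Newman at p_c(ℤ³): ∃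
b > 1/2, C with P(∃ y, ‖y‖_∞ ≥ r ∧ 0 ↔ y inside H = {x₀ ≥ 0}) ≤ C r^{−b} for all r ≥ 1. Same event
as PercLowPointHalfSpace.QuantitativeBGN (stmt-CriticalPhenomena-0913, ∃ a > 0), with the explicit
threshold 1/2; numerically b = x_s = 2 − y_{h1} ≈ 0.975 (DengBlote2005), rigorously b ≤ 2
(φ_{p_c}(Λ_r) ≥ 1). Publishable alone. [difficulty: open-problem] -/
@[route_item "route-CriticalPhenomena-PercBoundarySqueeze"]
def HalfSpaceOneArmRate : Prop :=
  ∃ b C : ℝ, 1 / 2 < b ∧ ∀ r : ℕ, 1 ≤ r → (Literature.Probability.Percolation.bondPercolation (Literature.Probability.LatticeModels.zdGraph 3) (Literature.Probability.Percolation.criticalProbI 3)).real {ω | ∃ y : Literature.Probability.LatticeModels.Site 3, (∃ i : Fin 3, (r : ℤ) ≤ |y i|) ∧ ω ∈ Literature.Probability.Percolation.openConnIn {x : Literature.Probability.LatticeModels.Site 3 | 0 ≤ x 0} 0 y} ≤ C * (r : ℝ) ^ (-b)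

/-- item stmt-CriticalPhenomena-6984 · support · rank 9 · closed · proved by Summit.CriticalPhenomena.PercolationContinuityZ3.Theorems.freeBoxSqueeze_proof @ 0cd248dbd2fe (prover) · by planner
sources: Zhang2000, AizenmanDuminilCopinSidoraviciusCMP2015, Grimmett1999
[support] UNCONDITIONAL squeeze (provable now, ~150 lines): for all R, n ≥ 1, θ(p_c)·|Λ_{⌊R/2⌋}| ≤ n
· Σ_{v ∈ ∂^{in}Λ_R} P(v ↔ Λ_{⌊R/2⌋} inside Λ_R) + Σ_{x ∈ Λ_{⌊R/2⌋}} P(|C_{Λ_R}(x)| ≥ n). Proof: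
pointwise, Σ_{x ∈ core} 1{x ↔ ∞} ≤ Σ_{x∈core} 1{x ↔ ∂^{in}Λ_R in Λ_R} = Σ_{exit pieces K} |K ∩ core|
≤ n·#{exit pieces meeting the core} + #{x ∈ core : |C_{Λ_R}(x)| ≥ n}, and each exit piece meeting
the core contains its own inner-boundary vertex joined to the core inside Λ_R; take expectations
(translation invariance θ_x = θ_0; measurability of openConnIn events, in tree). [difficulty:
provable-now] -/
@[route_item "route-CriticalPhenomena-PercBoundarySqueeze"]
def FreeBoxSqueeze : Prop :=
  ∀ R n : ℕ, 1 ≤ R → 1 ≤ n → Literature.Probability.Percolation.theta (Literature.Probability.LatticeModels.zdGraph 3) 0 (Literature.Probability.Percolation.criticalProbI 3) * ((Literature.Probability.LatticeModels.box 3 (R / 2)).card : ℝ) ≤ (n : ℝ) * ∑ v ∈ Literature.Probability.LatticeModels.innerBoundary (Literature.Probability.LatticeModels.zdGraph 3) (Literature.Probability.LatticeModels.box 3 R), (Literature.Probability.Percolation.bondPercolation (Literature.Probability.LatticeModels.zdGraph 3) (Literature.Probability.Percolation.criticalProbI 3)).real {ω | ∃ x ∈ Literature.Probability.LatticeModels.box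 3 (R / 2), ω ∈ Literature.Probability.Percolation.openConnIn (↑(Literature.Probability.LatticeModels.box 3 R) : Set (Literature.Probability.LatticeModels.Site 3)) v x} + ∑ x ∈ Literature.Probability.LatticeModels.box 3 (R / 2), (Literature.Probability.Percolation.bondPercolation (Literature.Probability.LatticeModels.zdGraph 3) (Literature.Probability.Percolation.criticalProbI 3)).real {ω | ∃ T : Finset (Literature.Probability.LatticeModels.Site 3), n ≤ T.card ∧ ∀ y ∈ T, ω ∈ Literature.Probability.Percolation.openConnIn (↑(Literature.Probability.LatticeModels.box 3 R) : Set (Literature.Probability.LatticeModels.Site 3)) x y}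

-- `FreeBoxSqueeze` holds: proved by `Summit.CriticalPhenomena.PercolationContinuityZ3.Theorems.freeBoxSqueeze_proof` @ 0cd248dbd2fe (its module imports this route file, so no `_holds` link can be stated here).

/-- item stmt-CriticalPhenomena-6985 · support · rank 9 · closed · proved by Summit.CriticalPhenomena.PercolationContinuityZ3.Theorems.boundaryArmCount_proof (prover) · by planner
sources: Zhang2000, BarskyGrimmettNewman1991, Grimmett1999
[support] (provable now, lattice-symmetry bookkeeping, ~200 lines) for R ≥ 1: Σ_{v ∈ ∂^{in}Λ_R} P(v
↔ Λ_{⌊R/2⌋} inside Λ_R) ≤ 6(2R+1)² · P(∃ y, (∃ i, ⌊R/2⌋ ≤ |y_i|) ∧ 0 ↔ y inside H): a vertex v on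
the face {x_i = ±R} joined inside Λ_R to the core is, after the lattice automorphism (reflection x_i
↦ R ∓ x_i, coordinate swap i ↔ 0, horizontal translation v ↦ 0; bondPercolation is invariant,
LatticeSymmetry/BondPercolationSymmetry in tree), the origin joined inside H to a point y with y₀ ≥
R − ⌊R/2⌋ ≥ ⌊R/2⌋; |∂^{in}Λ_R| ≤ 6(2R+1)². [difficulty: provable-now] -/
@[route_item "route-CriticalPhenomena-PercBoundarySqueeze"]
def BoundaryArmCount : Prop :=
  ∀ R : ℕ, 1 ≤ R → ∑ v ∈ Literature.Probability.LatticeModels.innerBoundary (Literature.Probability.LatticeModels.zdGraph 3) (Literature.Probability.LatticeModels.box 3 R), (Literature.Probability.Percolation.bondPercolation (Literature.Probability.LatticeModels.zdGraph 3) (Literature.Probability.Percolation.criticalProbI 3)).real {ω | ∃ x ∈ Literature.Probability.LatticeModels.box 3 (R / 2), ω ∈ Literature.Probability.Percolation.openConnIn (↑(Literature.Probability.LatticeModels.box 3 R) : Set (Literature.Probability.LatticeModels.Site 3)) v x} ≤ 6 * (2 * (R : ℝ) + 1) ^ 2 * (Literature.Probability.Percolation.bondPercolation (Literature.Probability.LatticeModels.zdGraph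 3) (Literature.Probability.Percolation.criticalProbI 3)).real {ω | ∃ y : Literature.Probability.LatticeModels.Site 3, (∃ i : Fin 3, ((R / 2 : ℕ) : ℤ) ≤ |y i|) ∧ ω ∈ Literature.Probability.Percolation.openConnIn {x : Literature.Probability.LatticeModels.Site 3 | 0 ≤ x 0} 0 y}

-- `BoundaryArmCount` holds: proved by `Summit.CriticalPhenomena.PercolationContinuityZ3.Theorems.boundaryArmCount_proof` (its module imports this route file, so no `_holds` link can be stated here).

/-- item stmt-CriticalPhenomena-6986 · assembly · rank 1 · closed · proved by Summit.CriticalPhenomena.PercolationContinuityZ3.Theorems.percBoundarySqueeze_assembly_proof @ 7b55018c4522 (prover) · by planner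
sources: BarskyGrimmettNewman1991, Zhang2000, Grimmett1999
[assembly] HalfSpaceOneArmRate → FreeBoxFatClusterMass → PercolationContinuityZ3 (via FreeBoxSqueeze
with n = ⌊R^{3/2}⌋, BoundaryArmCount, and R → ∞). -/
@[route_item "route-CriticalPhenomena-PercBoundarySqueeze"]
def Assembly : Prop :=
  HalfSpaceOneArmRate → FreeBoxFatClusterMass → PercolationContinuityZ3

-- `Assembly` holds: proved by `Summit.CriticalPhenomena.PercolationContinuityZ3.Theorems.percBoundarySqueeze_assembly_proof` @ 7b55018c4522 (its module imports this route file, so no `_holds` link can be stated here).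

/-! D-0027 §2.1 — DECIDING THEOREM (planner-authored via `route open/edit --closes-file`; by operator:999:875655 2026-08-15T14:45:22Z):
its hypotheses are this route's items and its conclusion the sub-problem Statement (glue_lint), and it elaborates with this file. -/

@[closes "route-CriticalPhenomena-PercBoundarySqueeze"] theorem closes : FreeBoxFatClusterMass → HalfSpaceOneArmRate → FreeBoxSqueeze → BoundaryArmCount → Assembly → _root_.PercolationContinuityZ3 := fun h_FreeBoxFatClusterMass h_HalfSpaceOneArmRate h_FreeBoxSqueeze h_BoundaryArmCount h_Assembly => h_Assembly h_HalfSpaceOneArmRate h_FreeBoxFatClusterMass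

end Summit.CriticalPhenomena.PercolationContinuityZ3.Theses.PercBoundarySqueeze
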